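import Literature.NumberTheory.Automorphic.PairLFunctionPolesRepDataRankTwo
import Literature.NumberTheory.Automorphic.LanglandsTunnellModThree
import Literature.NumberTheory.Automorphic.TunnellOctahedralGlobal
import Literature.NumberTheory.LFunctions.HeilbronnCharacter
import Literature.NumberTheory.LFunctions.DedekindZetaNonvanishing
import Literature.NumberTheory.GaloisRepresentations.GL2F3Lift
import HarnessLib

/-!
# stub-ideation k2 · generation 19 · `stub_modThree` — companion sketch (PLAN E)

Nothing registered.  Typed statements of the helper lemmas of `STUB-IDEAS-stub_modThree-2.md`
(g19, PLAN E), two kernel-checked sanity computations, and the PROVED composition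
`descentDetParity3_of_planE : E0 → E3 → D-P₃` that feeds the tree THEOREM
`JacquetShalika1981_partialPairL_pole_repData_rank_two` (Arthur–Clozel (2.3) on `GL₂`, sorry-free).

PLAN E (RESHAPE of g18's PLAN D).  PLAN D = PARITY of the quadratic descent `π₀` (D-P) + COHERENCE
by Deligne–Serre on the Galois side (D-R … D-T).  Its D-P was routed through Tunnell's cubic field
(`ha` + `hb` + `hd`), i.e. through the SAME leaves as the registered R1 road, so PLAN D was dominated.
PLAN E proves D-P with NO automorphic debt: in the mod-`3` cell `det σ = ω_E` (`E = ℚ(√-3)`), so the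
even ("bad") descent has Satake parameters `{c, c⁻¹}` with `{c², c⁻²} = {a², b²}` (`a, b` the
Frobenius eigenvalues of `σ`); its Rankin–Selberg square is
`L^S(s, π₀ × π₀) = ζ^S(s) · ζ^S_{K₄}(s) / L^S(s, ω_E)` (`K₄` = the quartic field of a line of `ρ̄`,
permutation character of `GL₂(𝔽₃)` on `ℙ¹(𝔽₃)` `= 1 + tr² − det`, `e2_core` below, `decide`) — a
DOUBLE pole at `s = 1` (Dedekind: `tendsto_sub_one_mul_dedekindZetaCont_holds`) — while the bad
descent is Satake-self-dual and unitary, so (2.3) (THEOREM in rank 2) makes the pole SIMPLE.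
Contradiction ⇒ parity.  Coherence stays with Deligne–Serre exactly as in g18 (D-R, D-K, D-E,
D-1a/b, D-T, `isModular_surj_of_planD` of `STUB_IDEAS_stub_modThree_2g18.lean`, whose hypothesis
`hpar` is what `descentDetParity3_of_planE` delivers in the mod-3 cell).
-/

set_option linter.dupNamespace false

noncomputable section

namespace Summit.ABC.ABC.Cruxes.FreyModularity.StubModThreeIdeasK2G19

open Literature Literature.NumberTheory Literature.NumberTheory.Automorphic
open Literature.NumberTheory.GaloisRepresentations
open IsDedekindDomain Polynomial Field Filter Topology NumberField
open scoped MatrixGroups NumberField Polynomial Classical Topology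

/-- The registered stub `stub_modThree`, verbatim (Lines/Sketch.lean l.143). -/
def SigStubModThree : Prop :=
  ∀ (W : WeierstrassCurve ℚ) [W.IsElliptic] (ρ : ModPGaloisRep ℚ (ZMod 3) 2),
    W.IsTorsionGaloisRep 3 ρ → FramedRep.IsAbsolutelyIrreducible ρ → ρ.IsModular

/-! ### The two a.e. shapes of the central character of a descent -/

/-- GOOD: `∏ t_{π₀,v} = det σ(Frob_v)` a.e. — the conclusion of D-P (g18 `SigDescentDetParity`). -/
def DetParityAE (hQ : isCompact_glFiniteIntegralLevel 2 ℚ) (π₀ : CuspidalAutomorphicRepData 2 ℚ hQ)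
    (σ : FramedArtinRep ℚ 2) : Prop :=
  ∀ᶠ v : HeightOneSpectrum (𝓞 ℚ) in cofinite, ∀ α β : Multiset ℂ,
    π₀.1.HasSatakeParamAt v α → σ.HasFrobCharpolyAt v (satakePolynomial β) → α.prod = β.prod

/-- TWISTED: `∏ t_{π₀,v} = ε_E(v) · det σ(Frob_v)` a.e. (the other descent's parity). -/
def TwistedDetParityAE (E : Type) [Field E] [NumberField E] [Algebra ℚ E]
    (hQ : isCompact_glFiniteIntegralLevel 2 ℚ) (π₀ : CuspidalAutomorphicRepData 2 ℚ hQ)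
    (σ : FramedArtinRep ℚ 2) : Prop :=
  ∀ᶠ v : HeightOneSpectrum (𝓞 ℚ) in cofinite, ∀ α β : Multiset ℂ,
    π₀.1.HasSatakeParamAt v α → σ.HasFrobCharpolyAt v (satakePolynomial β) →
      α.prod = quadraticSign E v * β.prod

/-- `det σ = ω_E` a.e. at the Frobenius level (in the mod-3 cell: `det Ψ(ρ̄(Frob_p)) = χ₃(p) = ε_{ℚ(√-3)}(p)`). -/
def DetIsQuadraticSignAE (E : Type) [Field E] [NumberField E] [Algebra ℚ E] (σ : FramedArtinRep ℚ 2) : Prop :=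
  ∀ᶠ v : HeightOneSpectrum (𝓞 ℚ) in cofinite, ∀ β : Multiset ℂ,
    σ.HasFrobCharpolyAt v (satakePolynomial β) → β.prod = quadraticSign E v

/-! ### E0 — central-sign dichotomy (M; central characters + CFT, every tool PROVED in the tree) -/

/-- **E0 (central-sign dichotomy).**  `E/ℚ` quadratic, `Π_E = π(σ_E)` exact, `π₀` a cuspidal weak
descent.  Then `ω_{π₀} = det σ` or `ω_{π₀} = det σ · ω_E`, read a.e. on Satake parameters.  Route:
`ω = ω_{π₀}` (`AutomorphicRepData.exists_centralCharacter`: `ω(ϖ_v) = ∏ t_{π₀,v}` a.e.) and the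
finite-order Hecke character `ω_σ` of `det σ` (`artinReciprocity_character_holds`) satisfy
`(ω/ω_σ)(ϖ_v)^{f(w|v)} = 1` a.e. (weak lift + exactness, `f ∈ {1,2}`,
`inertiaDeg_eq_one_or_two_of_finrank_eq_two`), so `χ = ω/ω_σ` has `χ² = 1`
(`HeckeCharacter.ext_of_eventually_valueAtUniformizer_eq`) and `χ(ϖ_v) = 1` at a.e. split `v`;
by reciprocity + Chebotarev over `E` (`chebotarev_artinRep_holds`) `χ|_{Γ_E} = 1`, i.e.
`χ ∈ {1, η_E}` (`exists_heckeCharacter_quadraticSign_of_finrank_eq_two`).  Pattern: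
`shift_eq_zero_of_centralCharacters` (ArthurClozelFibresShiftKilling). -/
def SigCentralSignDichotomy : Prop :=
  ∀ (E : Type) [Field E] [NumberField E] [Algebra ℚ E], Module.finrank ℚ E = 2 →
    ∀ (σ : FramedArtinRep ℚ 2) (hQ : isCompact_glFiniteIntegralLevel 2 ℚ)
      (hE : isCompact_glFiniteIntegralLevel 2 E) (PE : CuspidalAutomorphicRepData 2 E hE),
      IsPiOfArtinRep (σ.restrictField E) PE.1 →
    ∀ (π₀ : CuspidalAutomorphicRepData 2 ℚ hQ), IsWeakBaseChangeLiftAE π₀.1 PE.1 →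
      DetParityAE hQ π₀ σ ∨ TwistedDetParityAE E hQ π₀ σ

/-! ### E1 — the bad local shape forces the pair products (S, pure algebra) -/

/-- **E1.**  `α = {c, d}`, `cd = 1`, `{c², d²} = {a², b²}` ⇒ the four pair products of `α ⊗ α` are
`{a², b², 1, 1}`:  `satakePairPolynomial α α = (1 - X)² (1 - a²X)(1 - b²X)`. -/
def SigPairPolynomialOfBadShape : Prop :=
  ∀ (α β : Multiset ℂ), Multiset.card α = 2 → Multiset.card β = 2 → α.prod = 1 →
    α.map (· ^ 2) = β.map (· ^ 2) →
      satakePairPolynomial α α = (1 - X) ^ 2 * ((β.map (· ^ 2)).map fun b => 1 - C b * X).prod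

/-! ### E2 — the permutation character of `GL₂(𝔽₃)` on `ℙ¹(𝔽₃)` (kernel-checked here) -/

section E2
open GL2F3Lift GL2F3Lift.M2

/-- The four lines of `𝔽₃²`, by representatives. -/
def lineReps : List (ZMod 3 × ZMod 3) := [(1, 0), (0, 1), (1, 1), (1, 2)]

/-- `x̄ · v` for `x ∈ Ψ(GL₂(𝔽₃)) ⊂ GL₂(ℤ[√-2])` reduced mod `𝔭 = (1 + √-2)` (`GL2F3Lift.red`). -/
def actRed (x : M2) (v : ZMod 3 × ZMod 3) : ZMod 3 × ZMod 3 :=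
  (red x.a * v.1 + red x.b * v.2, red x.c * v.1 + red x.d * v.2)

/-- Number of lines of `𝔽₃²` fixed by `x̄` = number of fixed points of `x̄` on `ℙ¹(𝔽₃) = G/B`,
i.e. the character of `Ind_B^{GL₂(𝔽₃)} 1` at `x̄`. -/
def fixedLineCount (x : M2) : ℕ :=
  lineReps.countP fun v => actRed x v = v ∨ actRed x v = (-v.1, -v.2)

/-- Trace of the lift `x = Ψ(x̄) ∈ GL₂(ℤ[√-2])`. -/
def trM (x : M2) : ℤ√(-2) := x.a + x.d

/-- **E2 (core, `decide`).**  For every `g ∈ GL₂(𝔽₃)`:  `#Fix(g | ℙ¹(𝔽₃)) = 1 + (tr Ψ g)² − det Ψ g`,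
i.e. `Ind_B^G 1 = 1 ⊕ (Sym² Ψ ⊗ ?)`… precisely `perm = 1 + Sym²Ψ − 2·det Ψ + det Ψ`-free form:
`χ_perm = 1 + χ_Ψ² − det Ψ = 1 + χ_{Sym²Ψ}` (as `χ_{Sym²} = χ² − det` in rank 2).  Hence for
`σ = Ψ ∘ ρ̄` with `ρ̄` onto `GL₂(𝔽₃)`:  `Sym² σ ⊕ 1 ≃ Ind_{Γ_{K₄}}^{Γ_ℚ} 1`, `K₄ = ℚ̄^{ρ̄⁻¹(B)}` quartic. -/
theorem e2_core : ∀ x ∈ elems, ((fixedLineCount x : ℤ) : ℤ√(-2)) = 1 + trM x * trM x - M2.det x := by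
  decide

/-- Sanity: the count takes exactly the values `4, 2, 1, 0` (identity/−1; transpositions;
3- and 6-elements; 4- and 8-elements). -/
theorem e2_values : ∀ x ∈ elems, fixedLineCount x ∈ [0, 1, 2, 4] := by decide

end E2

/-! ### E3 — the even descent contradicts Arthur–Clozel (2.3) (M–L; packaged) -/

/-- **E3 (even descent ⇒ no simple pole).**  Mod-3 cell: `ρ̄` onto `GL₂(𝔽₃)`, `σ = Ψ ∘ ρ̄`,
`E` quadratic with `det σ = ε_E` a.e., `Π_E = π(σ_E)` exact, `π₀` a cuspidal weak descent with the
TWISTED parity.  Then for every finite `S₀` there are a finite `S ⊇ S₀` and a Satake family `α` of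
`π₀` off `S` satisfying the hypotheses of (2.3) at `s₀ = 1` for the pair `(π₀, π₀)` (unitary central
value `‖∏ α_v‖ = 1`, self-duality `α_v⁻¹ = α_v`), yet `(s - 1) L^S(s, π₀ × π₀)` has NO finite limit
as `s → 1⁺`.  Internal route (each one cycle): E3a bad local shape a.e. (`α_v = {c, c⁻¹}`,
`{c², c⁻²} = {a², b²}`: weak lift at inert `v` squares, exactness of `Π_E`, split `v` give `α = β`);
E3b = E1 + E2: Euler factor of `L^S(π₀ × π₀)` at `v ∉ S` is `ζ_v · L_v(Ind_{K₄} 1) / L_v(ε_E)`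
(`ArtinRep.eulerFactorAt` of `ArtinRep.monomial hq B 1`, `eulerFactorAt_spec`); E3c on `re s > 1`,
`partialPairL S α α = ζ^S · (artinLFunction (monomial hq B 1))^S / L^S(ε_E)`
(`artinLFunction_eulerProduct_holds`, `artinLFunction_cutCharacter_one`: `= ζ_{K₄}`); E3d orders at
`1`: `(s-1)ζ^S → c₁ ≠ 0` (`riemannZeta_residue_one`), `‖ζ^S_{K₄}(s)‖ → ∞`
(`tendsto_sub_one_mul_dedekindZetaCont_holds`, `dedekindZetaCont_eq_dedekindZeta_holds`),
`L^S(s, ε_E) → c₃ ≠ 0` (`DirichletCharacter.LFunction_ne_zero_of_one_le_re`); E3e filter algebra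
(`SigNoFiniteLimitOfDoublePole`) + `parity_skeleton`. -/
def SigEvenDescentContradictsJS : Prop :=
  ∀ (ρ : ModPGaloisRep ℚ (ZMod 3) 2), Function.Surjective ρ →
  ∀ (E : Type) [Field E] [NumberField E] [Algebra ℚ E], Module.finrank ℚ E = 2 →
    DetIsQuadraticSignAE E (modThreeLift ρ) →
  ∀ (hQ : isCompact_glFiniteIntegralLevel 2 ℚ) (hE : isCompact_glFiniteIntegralLevel 2 E)
    (PE : CuspidalAutomorphicRepData 2 E hE), IsPiOfArtinRep ((modThreeLift ρ : FramedArtinRep ℚ 2).restrictField E) PE.1 →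
  ∀ (π₀ : CuspidalAutomorphicRepData 2 ℚ hQ), IsWeakBaseChangeLiftAE π₀.1 PE.1 →
    TwistedDetParityAE E hQ π₀ (modThreeLift ρ) →
    ∀ S₀ : Set (HeightOneSpectrum (𝓞 ℚ)), S₀.Finite →
      ∃ S : Set (HeightOneSpectrum (𝓞 ℚ)), S.Finite ∧ S₀ ⊆ S ∧ ∃ α : SatakeFamily ℚ,
        (∀ w ∉ S, π₀.1.HasSatakeParamAt w (α w)) ∧ (∀ w ∉ S, ‖(α w).prod‖ = 1) ∧
        (∀ᶠ w in cofinite, (α w).map (((w.residueCard : ℂ) ^ (1 - (1 : ℂ))) * ·) = (α w).map (·⁻¹)) ∧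
        ∀ c : ℂ, ¬ Tendsto (fun s => (s - 1) * partialPairL S α α s) (𝓝[{s : ℂ | 1 < s.re}] 1) (𝓝 c)

/-- **E3e (filter algebra, S, pure Mathlib).**  A product `u · v / w` with `u → c₁ ≠ 0`, `‖v‖ → ∞`,
`w → c₃ ≠ 0` along a proper filter has no finite limit. -/
def SigNoFiniteLimitOfDoublePole : Prop :=
  ∀ (F : Filter ℂ) [F.NeBot] (f u v w : ℂ → ℂ) (c₁ c₃ : ℂ), c₁ ≠ 0 → c₃ ≠ 0 →
    (∀ᶠ s in F, f s = u s * v s / w s) → Tendsto u F (𝓝 c₁) →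
    Tendsto (fun s => ‖v s‖) F atTop → Tendsto w F (𝓝 c₃) → ∀ c : ℂ, ¬ Tendsto f F (𝓝 c)

/-- **The logical skeleton of PLAN E's parity step** (kernel-checked): a dichotomy, a finite limit
in the bad branch (Arthur–Clozel (2.3)), and divergence in the bad branch (Dedekind pole of `ζ_{K₄}`)
leave only the good branch. -/
theorem parity_skeleton {ι : Type*} {F : Filter ι} [F.NeBot] {f : ι → ℂ} {Good Bad : Prop}
    (hdich : Good ∨ Bad) (hJS : Bad → ∃ c : ℂ, Tendsto f F (𝓝 c))
    (hdiv : Bad → Tendsto (fun x => ‖f x‖) F atTop) : Good := by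
  rcases hdich with h | hb
  · exact h
  · obtain ⟨c, hc⟩ := hJS hb
    exact absurd (hdiv hb) (hc.norm.not_tendsto (disjoint_nhds_atTop ‖c‖))

/-! ### E-P — D-P in the mod-3 cell, PROVED from E0 + E3 + the tree theorem (2.3) -/

/-- **D-P₃ (parity of the descent, mod-3 cell).**  g18's `SigDescentDetParity` specialised to
`σ = Ψ ∘ ρ̄`, `ρ̄` onto `GL₂(𝔽₃)`, `E` the quadratic field with `det σ = ε_E`. -/
def SigDescentDetParity3 : Prop :=
  ∀ (ρ : ModPGaloisRep ℚ (ZMod 3) 2), Function.Surjective ρ →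
  ∀ (E : Type) [Field E] [NumberField E] [Algebra ℚ E], Module.finrank ℚ E = 2 →
    DetIsQuadraticSignAE E (modThreeLift ρ) →
  ∀ (hQ : isCompact_glFiniteIntegralLevel 2 ℚ) (hE : isCompact_glFiniteIntegralLevel 2 E)
    (PE : CuspidalAutomorphicRepData 2 E hE), IsPiOfArtinRep ((modThreeLift ρ : FramedArtinRep ℚ 2).restrictField E) PE.1 →
  ∀ (π₀ : CuspidalAutomorphicRepData 2 ℚ hQ), IsWeakBaseChangeLiftAE π₀.1 PE.1 →
    DetParityAE hQ π₀ (modThreeLift ρ)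

/-- **PLAN E parity assembly (PROVED):** E0 + E3 + Arthur–Clozel (2.3) on `GL₂`
(`JacquetShalika1981_partialPairL_pole_repData_rank_two`, a THEOREM of the tree) ⇒ D-P₃. -/
theorem descentDetParity3_of_planE (h0 : SigCentralSignDichotomy) (h3 : SigEvenDescentContradictsJS) :
    SigDescentDetParity3 := by
  intro ρ hsurj E _ _ _ hE2 hdet hQ hE PE hPE π₀ hBC
  rcases h0 E hE2 (modThreeLift ρ) hQ hE PE hPE π₀ hBC with hgood | htw
  · exact hgood
  · exfalso
    obtain ⟨S₀, hS₀, hJS⟩ := JacquetShalika1981_partialPairL_pole_repData_rank_two hQ π₀ π₀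
    obtain ⟨S, hS, hsub, α, hα, hu, hX, hno⟩ :=
      h3 ρ hsurj E hE2 hdet hQ hE PE hPE π₀ hBC htw S₀ hS₀
    obtain ⟨c, -, hc⟩ := hJS hS hsub hα hα hu hu (s₀ := 1) (by simp) hX
    exact hno c hc

/-! ### E-D — the det field (S): `det (Ψ ∘ ρ̄) = ε_{ℚ(√-3)}` a.e. -/

/-- **E-D.**  For `ρ̄` odd onto `GL₂(𝔽₃)` and `E = ℚ̄^{ker (det ρ̄)}` (`= ℚ(√-3)` for `ρ̄ = ρ̄_{W,3}` by
`det ρ̄ = χ₃`, `det_of_isTorsionGaloisRep`): `[E:ℚ] = 2`, the projective image of `σ_E` has order 12,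
and `det σ(Frob_v) = ε_E(v)` a.e. (Frobenius lies in the index-2 subgroup iff `v` splits). -/
def SigDetField : Prop :=
  ∀ (ρ : ModPGaloisRep ℚ (ZMod 3) 2), Function.Surjective ρ → FramedGaloisRep.IsOdd ρ →
    ∃ (E : Type) (_ : Field E) (_ : NumberField E) (_ : Algebra ℚ E), Module.finrank ℚ E = 2 ∧
      DetIsQuadraticSignAE E (modThreeLift ρ) ∧
      Nat.card (projectiveImage ((modThreeLift ρ : FramedArtinRep ℚ 2).restrictField E).toMonoidHom) = 12

end Summit.ABC.ABC.Cruxes.FreyModularity.StubModThreeIdeasK2G19
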